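import Literature.NumberTheory.EllipticCurves.BurungaleCastellaSkinner2025.BDPMainConjecture
import HarnessLib

/-!
# Castella–Çiperiani–Skinner–Sprung (arXiv:1804.10993v2, PREPRINT since 2018), §5.1: Theorem 5.7 with
# Lemma 5.5 — the ANNOUNCED Howard-direction divisibility `Char_Λ(𝔛^{rel,str}_{K_∞^ac}(f))·Λ_ur ⊇ (L_p^BDP)`
# with `Λ`-torsion, at an odd prime of good NON-ORDINARY reduction split in `K` (so `p = 3`, `a_3 ∈ {0, ±3}`
# included), `N⁻ = 1` allowed — as ONE explicitly labelled OPEN claim in the frame currency of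
# `BurungaleCastellaSkinner2025.thm421b_exists_isBDPLFunction_isTorsion_mem_charIdeal`

HONEST FRAMING (cell `pub/bsd-wall`, D-0131 (3) MIDDLE tier, prover seat `bsd-wall-utd-p2` g2; the cell's
lane-2 typer `bsd-wall-ty-1` was asked first, STATUS 15:37Z/15:42Z). A PREPRINT's theorem enters the tree
ONLY as an explicitly labelled OPEN claim (`def … : Prop`, nothing asserted, no `_holds`, no `sorry`),
NEVER as a fact — the pattern of this directory's `NonordinaryPPartOPEN.lean` (Thms. C/D of the same
preprint). Typed ≠ proved ≠ endorsed; BSD is not advanced by this file. WHY (consumer by name): route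
`UniversalToricDescent`, crux #3 `TwinSplitIMCAtThree` (stmt-BirchSwinnertonDyer-20214) on census bucket C
(603 of the 2 023 twin classes have only good-SUPERSINGULAR twins at `3`): the kernel file
`Summits/…/Theorems/UniversalToricDescentTwinSplitIMCAtThreeOfThreeFrames.lean` (p543791) reduces the crux
at a good twin to ONE Howard-direction frame and ONE Wan-direction frame; at `p = 3` the Howard frame for
a supersingular twin is in NO refereed print (Castella–Wan, Math. Ann. 389 (2024) §5.4 Thm. 5.12:
`p > 3`, `p ∤ 6N_fD_K`, `G_K ↠ Aut_{ℤ_p}(T)` `[corpus: paper:arxiv-1607.02019 p0021 L51–L60, p0011 L6,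
p0007 L5]`; Longo–Vigni BUMI 12 (2019): `p ≥ 5` `[corpus: paper:arxiv-1503.07812 p0003 L17]`;
Kobayashi–Ota 2020, Burungale–Büyükboduk–Lei II: `p ≥ 5`) and in exactly ONE preprint, typed here.

Source (read first-hand by this seat, 2026-08-27: `paper:arxiv-1804.10993` chunks p0010, p0016–p0017,
p0021–p0023; v2 of 2018; the tree's `NonordinaryPPartOPEN.lean` records "Crossref 2026-08-19: no
journal version"). F. Castella, M. Çiperiani, C. Skinner, F. Sprung, *On the Iwasawa main conjectures
for modular forms at non-ordinary primes* [CastellaCiperianiSkinnerSprung2018]. VERBATIM: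
* §4 standing (p0016 L3–L27): "Throughout this section, we let `f = Σ a_n q^n ∈ S₂^new(Γ₀(N))` be a
  newform, and `p > 2` be a prime of good non-ordinary reduction for `f` as before. The imaginary quadratic
  field `K` (in which we continue to assume that `p = 𝔭𝔭̄` split) determines a factorization `N = N⁺N⁻` …
  `ℓ ∣ N⁺` if and only if `ℓ` is split or ramified in `K`, `ℓ ∣ N⁻` if and only if `ℓ` is inert in `K`. We
  shall assume that `N⁻` is square-free, and say that the pair `(f, K)` is indefinite (resp. definite) if
  `N⁻` is the product of an even (resp. odd) number of primes"; §4.1 (L26): "Let `X = X_{N⁺,N⁻}` be the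
  Shimura curve (with the cusps added if `N⁻ = 1`)".
* Def. 2.10–2.11 (p0010 L69–L117): `𝔖𝔢𝔩^{p}(K, 𝐌)` = classes unramified at `v ∈ Σ ∖ {p}`;
  "`Sel^{rel,str}(K, 𝐌)` is the submodule of `Sel^{p}(K, 𝐌)` consisting of classes which are trivial
  at `𝔭̄` (with no condition at `𝔭`)"; `𝔛` = Pontryagin dual of the `𝐀^ac`-version.
* Thm. 4.7 (p0017 L116–L133): "There exists an element `𝓛^BDP_𝔭(f/K) ∈ Λ_ur(Γ^ac)` such that if
  `ψ : Γ^ac → ℂ_p^×` has trivial conductor and infinity type `(−m, m)` with `m > 0`, then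
  `(ψ(𝓛^BDP_𝔭(f/K))/Ω_p^{2m})² = Γ(m)Γ(m+1)·(1 − p⁻¹ψ(𝔭)α)²(1 − p⁻¹ψ(𝔭)β)²·L(f/K,ψ,1)/(π^{2m+1}·Ω_K^{4m})`,
  where `(Ω_p, Ω_K) ∈ ur^× × ℂ^×` are CM periods attached to `K`. Moreover, `𝓛_𝔭^BDP(f/K)` is nonzero,
  and if `ρ̄_f|_{G_K}` is absolutely irreducible, the `μ`-invariant of `𝓛_𝔭^BDP(f/K)` vanishes."
* Lemma 5.5 (p0021 L109–L137): "Let `∙ ∈ {♯, ♭}`, and assume that `𝔖𝔢𝔩^{∙,∙}(K, 𝐓^ac)` has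
  `Λ(Γ^ac)`-rank `1`. Then … • `𝔛^{rel,str}_{K_∞^ac}(f)` is `Λ(Γ^ac)`-torsion, and for any height one prime
  of `Λ(Γ^ac)`, we have `length_𝔓(𝔛^{rel,str}_{K_∞^ac}(f)) = length_𝔓(𝔛^{∙,∙}_{K_∞^ac}(f)_tors) +
  2 length_𝔓(coker(res_𝔭))` and `ord_𝔓(c·𝓛^BDP_𝔭(f/K)) = length_𝔓(coker(res_𝔭)) +
  length_𝔓(𝔖𝔢𝔩^{∙,∙}(K,𝐓^ac)/Λ(Γ^ac)·ℨ_c^∙)`".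
* **Theorem 5.7** (p0022 L79–L97): "Let `∙ ∈ {♯, ♭}`, and assume that `ρ̄_f|_{G_K}` is irreducible. Then
  both `𝔛^{∙,∙}_{K_∞^ac}(f)` and `𝔖𝔢𝔩^{∙,∙}(K, 𝐓^ac)` have `Λ(Γ^ac)`-rank `1`, and we have the divisibility
  `c²·Char_{Λ(Γ^ac)}(𝔛^{∙,∙}_{K_∞^ac}(f)_tors) ⊇ Char_{Λ(Γ^ac)}(𝔖𝔢𝔩^{∙,∙}(K,𝐓^ac)/Λ(Γ^ac)·ℨ_c^∙)²`.
  *Proof.* This follows from a straightforward adaptation of the arguments in the last paragraph of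
  [cas-wan-ss] …".
* Proof of Thm. 5.8, first display (p0023 L2–L17): "From Theorem 5.7 and Lemma 5.5, we know that
  `𝔖𝔢𝔩^{∙,∙}(K,𝐓^ac)` and `𝔛^{∙,∙}_{K_∞^ac}(f)` both have `Λ(Γ^ac)`-rank `1`, `𝔛^{rel,str}_{K_∞^ac}(f)` is
  `Λ(Γ^ac)`-torsion, and for any height one prime `𝔓` of `Λ(Γ^ac)`, the inequalities …
  `length_𝔓(𝔛^{rel,str}_{K_∞^ac}(f)) ⩽ 2 length_𝔓(𝓛^BDP_𝔭(f/K))` hold." (The remaining hypotheses of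
  Thm. 5.8 — `N` square-free, a non-split prime — feed only the opposite, Wan-direction inclusion via
  Thm. 5.1; they are NOT hypotheses of the claim typed here.)

TRANSCRIPTION (tree dictionary of `BurungaleCastellaSkinner2025/BDPMainConjecture.lean`): exactly the
binders of `thm421b_exists_isBDPLFunction_isTorsion_mem_charIdeal` with `GoodSS W p` (good reduction,
`p ∣ a_p` = "non-ordinary") in place of `GoodOrd W p`, WITHOUT the (disc) binders (`Odd (discr K)`,
`discr K ≠ −3`: not printed in §§4–5) and WITHOUT the (sur) clause; classical Heegner hypothesis =
the special case `N⁻ = 1`; `𝔛^{rel,str}_{K_∞^ac}(f)` read as `AcSelmer.XAc (W.baseChange K) p κ vbar ∅ γ`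
(strict at the prime `vbar` OPPOSITE to the prime `v` of the frame's embedding datum — cell typing
checklist T1 — the same reading as BCS's `X_Gr`, flag `BCS-124-XGr-reading`; the unramified-outside-`p`
structure `𝔖𝔢𝔩` vs the Selmer group proper is the preprint's own "[pollack-weston] (see also [cas-mult])"
comparison — reading flag `CCSS18-frakX-reading`); `(𝓛^BDP_𝔭)² = L_p^BDP` read through the frame
predicate `IsBDPLFunction` (normalisation of Castella 2018 Thm. 3.1, as in every BCS fact); `Λ`-torsion
asserted as a conjunct of the conclusion (checklist T11: char-ideal inclusions are input-free off the
torsion locus). STATUS of the binder: PRE (announced 2018, unrefereed; its own inputs [cas-wan-ss] =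
Castella–Wan is refereed at `p > 3` only). NEVER cite this `Prop` as a theorem.

## References
* [CastellaCiperianiSkinnerSprung2018] arXiv:1804.10993v2: Def. 2.10–2.11, §4 (standing), Thm. 4.7,
  Lemma 5.5, Thm. 5.7, Thm. 5.8 (proof, first display).
* [CastellaWan2024PerrinRiou] F. Castella, X. Wan, Math. Ann. 389 (2024) = arXiv:1607.02019, §5.4
  Thm. 5.12 (the refereed `p > 3` version of the Kolyvagin-system argument).
* [BurungaleCastellaSkinner2025] Thm. 4.2.1 (b) (the ordinary twin of this statement; tree
  `BDPMainConjecture.lean`); [Castella2018] Thm. 3.1 (the normalisation `IsBDPLFunction`);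
  [Howard2004HeegnerKolyvagin] (the Kolyvagin-system axiomatics H.0–H.5, `p` odd).
-/

noncomputable section

open scoped Classical


namespace Literature.NumberTheory.EllipticCurves.CastellaCiperianiSkinnerSprung2018

open PowerSeries WeierstrassCurve NumberField IsDedekindDomain Field
  Literature.NumberTheory.EllipticCurves Literature.NumberTheory.EllipticCurves.ModularForms
  Literature.NumberTheory.QuadraticFields Literature.NumberTheory.EllipticCurves.Rank1Residual
  Literature.NumberTheory.EllipticCurves.Castella2018

/-- **OPEN CLAIM — UNREFEREED PREPRINT (Castella–Çiperiani–Skinner–Sprung, arXiv:1804.10993v2, 2018),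
Theorem 5.7 with Lemma 5.5, as combined in the first display of the proof of Theorem 5.8 (§5.1)**, for
the newform of an elliptic curve. Standing (§4, p. 16): "`f ∈ S₂^new(Γ₀(N))` a newform, and `p > 2` a
prime of good non-ordinary reduction for `f` … `K` (in which we continue to assume that `p = 𝔭𝔭̄`
split) … We shall assume that `N⁻` is square-free, and say that the pair `(f, K)` is indefinite … if
`N⁻` is the product of an even … number of primes"; §4.1: "`X = X_{N⁺,N⁻}` the Shimura curve (with the
cusps added if `N⁻ = 1`)". Thm. 4.7: "There exists an element `𝓛_𝔭^BDP(f/K) ∈ Λ_ur(Γ^ac)` such that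
if `ψ : Γ^ac → ℂ_p^×` has trivial conductor and infinity type `(−m, m)` with `m > 0`, then
`(ψ(𝓛_𝔭^BDP(f/K))/Ω_p^{2m})² = Γ(m)Γ(m+1)·(1 − p⁻¹ψ(𝔭)α)²(1 − p⁻¹ψ(𝔭)β)²·L(f/K,ψ,1)/(π^{2m+1}·Ω_K^{4m})`,
where `(Ω_p, Ω_K) ∈ ur^× × ℂ^×` are CM periods attached to `K`." Thm. 5.7: "Let `∙ ∈ {♯, ♭}`, and
assume that `ρ̄_f|_{G_K}` is irreducible. Then both `𝔛^{∙,∙}_{K_∞^ac}(f)` and `𝔖𝔢𝔩^{∙,∙}(K, 𝐓^ac)`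
have `Λ(Γ^ac)`-rank `1`, and we have the divisibility `c²·Char_{Λ(Γ^ac)}(𝔛^{∙,∙}_{K_∞^ac}(f)_tors) ⊇
Char_{Λ(Γ^ac)}(𝔖𝔢𝔩^{∙,∙}(K,𝐓^ac)/Λ(Γ^ac)·ℨ_c^∙)²`." Lemma 5.5 (second bullet): "`𝔛^{rel,str}_{K_∞^ac}(f)`
is `Λ(Γ^ac)`-torsion, and for any height one prime [`𝔓`] of `Λ(Γ^ac)`, we have
`length_𝔓(𝔛^{rel,str}_{K_∞^ac}(f)) = length_𝔓(𝔛^{∙,∙}_{K_∞^ac}(f)_tors) + 2 length_𝔓(coker(res_𝔭))` and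
`ord_𝔓(c·𝓛_𝔭^BDP(f/K)) = length_𝔓(coker(res_𝔭)) + length_𝔓(𝔖𝔢𝔩^{∙,∙}(K,𝐓^ac)/Λ(Γ^ac)·ℨ_c^∙)`".
Proof of Thm. 5.8, first display (p. 23): "From Theorem 5.7 and Lemma 5.5, we know that …
`𝔛^{rel,str}_{K_∞^ac}(f)` is `Λ(Γ^ac)`-torsion, and for any height one prime `𝔓` of `Λ(Γ^ac)`, the
inequalities … `length_𝔓(𝔛^{rel,str}_{K_∞^ac}(f)) ⩽ 2 length_𝔓(𝓛^BDP_𝔭(f/K))` hold." (`𝔛^{rel,str}` =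
Pontryagin dual of `𝔖𝔢𝔩^{rel,str}(K, 𝐀^ac)`, Def. 2.10–2.11: unramified outside `p`, no condition at
`𝔭`, trivial at `𝔭̄`.) TRANSCRIBED for an elliptic curve `W/ℚ` (globally minimal) with newform `f` of
level `N` in the shape of `BurungaleCastellaSkinner2025.thm421b_exists_isBDPLFunction_isTorsion_mem_charIdeal`:
`p ≠ 2`, `GoodSS W p` (good, `p ∣ a_p`: "non-ordinary" — at `p = 3` this INCLUDES `a_3 = ±3`, the
paper's `♯/♭` setting); `K` imaginary quadratic with the CLASSICAL Heegner hypothesis for `N` (the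
special case `N⁻ = 1`, all `ℓ ∣ N` split), (spl) as `#primesOver(p) = 2`, (irr_K); `v ∋ p` the prime of
the embedding datum `ι'`, `vbar ∋ p` the other prime; `κ` anticyclotomic with topological generator `γ`;
`𝔛^{rel,str}_{K_∞^ac}(f)` read as `AcSelmer.XAc (W.baseChange K) p κ vbar ∅ γ` (the SAME reading as BCS's
`X_Gr`, flag `BCS-124-XGr-reading`; the unramified-outside-`p` Selmer structure `𝔖𝔢𝔩` vs the true
Selmer group is the preprint's own [pollack-weston]/[cas-mult] comparison, reading flag
`CCSS18-frakX-reading`); `(𝓛_𝔭^BDP)² = L_p^BDP` read through the tree's frame predicate `IsBDPLFunction`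
(normalisation of Castella 2018 Thm. 3.1, flag as in the BCS facts). Conclusion: a frame
`(Ω_K ≠ 0, Ω_p ∈ R₀ˣ, L)` with `IsBDPLFunction ι' v κ γ f Ω_K Ω_p L`, `X` `Λ`-torsion, and along every
structure map `j : ℤ_p → R₀`, `L ∈ ch_Λ(X)·R₀⟦T⟧` (the divisibility `Char_Λ(𝔛^{rel,str})·Λ_ur ⊇ (L_p^BDP)`).
NO (disc) and NO class-number hypothesis is printed in §§4–5 (contrast Castella–Wan, Math. Ann. 389
(2024) §2: `p ∤ 6N_fD_K`, `p > 3`, `G_K ↠ Aut_{ℤ_p}(T)` — the REFEREED version of the same argument,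
which does NOT reach `p = 3`). Frame ∃-quantified ⇒ WEAKER than the claim. NEVER cite this `Prop` as a
theorem; take it as an explicit hypothesis. -- TODO(general form): newforms with arbitrary Hecke field
`L`; `N⁻` square-free indefinite (Shimura curves `X_{N⁺,N⁻}`), `N⁺` allowed to contain ramified primes.
[claim: CastellaCiperianiSkinnerSprung2018, status: under-review]
[cite: CastellaCiperianiSkinnerSprung2018, Thm. 5.7, Lemma 5.5, proof of Thm. 5.8 (arXiv:1804.10993v2 §5.1, pp. 21–23); §4 standing (p. 16); Thm. 4.7 (p. 17); Def. 2.10–2.11 (p. 10)]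
[cite: Castella2018, Thm. 3.1 (the normalisation `IsBDPLFunction`)] -/
def thm57_lemma55_exists_isBDPLFunction_isTorsion_mem_charIdeal_OPEN : Prop :=
  ∀ {p : ℕ} [Fact p.Prime] (ι' : PadicAlgCl p ≃+* ℂ) (W : WeierstrassCurve ℚ) [W.IsElliptic]
    [W.IsGloballyMinimal] (K : Type) [Field K] [NumberField K] (v vbar : HeightOneSpectrum (𝓞 K))
    (κ : ZpExtension K p) (γ : absoluteGaloisGroup K) [Fact (κ.IsTopGenerator γ)] {N : ℕ} [NeZero N]
    {f : CuspForm (CongruenceSubgroup.Gamma0 N) 2} (_ : IsNewformOf W f),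
    p ≠ 2 → GoodSS W p →
    IsImaginaryQuadratic K → SatisfiesHeegnerHypothesis N K →
      ((Ideal.span {(p : ℤ)}).primesOver (𝓞 K)).ncard = 2 →
      (W.baseChange K).HasIrreducibleModPGaloisRep p →
    (∀ (w : InfinitePlace K) (k : 𝓞 K), k ∈ v.asIdeal ↔ ‖ι'.symm (w.embedding (k : K))‖ < 1) →
      ((p : ℕ) : 𝓞 K) ∈ vbar.asIdeal → vbar ≠ v →
    κ.IsAnticyclotomic →
    ∃ (ΩK : ℂ) (Ωp : (unrIntegers p)ˣ) (L : UnrSeries p),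
      ΩK ≠ 0 ∧ IsBDPLFunction ι' v κ γ f ΩK ((Ωp : unrIntegers p) : ℂ_[p]) L ∧
      Module.IsTorsion (IwasawaAlgebra p) (AcSelmer.XAc (W.baseChange K) p κ vbar ∅ γ) ∧
      ∀ (j : ℤ_[p] →+* unrIntegers p),
        (∀ x : ℤ_[p], ((j x : unrIntegers p) : ℂ_[p]) = algebraMap ℚ_[p] ℂ_[p] (x : ℚ_[p])) →
        L ∈ (AcSelmer.XAc.charIdeal (W.baseChange K) p κ vbar ∅ γ).map (PowerSeries.map j)


end Literature.NumberTheory.EllipticCurves.CastellaCiperianiSkinnerSprung2018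

end
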